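import Summits.BirchSwinnertonDyer.BirchSwinnertonDyer.Theorems.ConjSpanGenAllLevelsDefs
import HarnessLib

/-!
# THEOREM B: the cyclotomic winding classes span `pr Γ_H(N)` for EVERY level — `ConjSpanGen N p` for all
# `N ≥ 1` and all primes `p ∤ N` — PART 2/3: the hypotheses (h1), (h2) of the orbit trick, (V) ⟹ (E′), and (h3), (h3′) by row/column reduction over `ℤ[1/p]`

Summit `BirchSwinnertonDyer`, `Theorems/`; namespace `Summit.BirchSwinnertonDyer.BirchSwinnertonDyer.Theorems.ConjSpanGenAllLevels`
(shared by the three parts, so every FQN is the author's). PROVENANCE, CREDIT, HONEST FRAMING AND REFERENCES: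
see the module docstring of PART 1/3, `ConjSpanGenAllLevelsDefs.lean` — the mathematics (MEMO-an §13
«THEOREM B», cell bsd-f3-mu) and the Lean text are seat bsd-f3-mu-an g4/g5's `pub/bsd-f3-mu/an/g5/TheoremB.lean`
(sha16 583a2ab32092eff9, audited: bsd-f3-mu ref1/ref2, bsd-print-x8 plan g5, ref g5 R-74/R-90/R-92), filed
VERBATIM by cell bsd-print-x8's typer ty2 g6 (`HOME/ty2/ConjSpanGenAllLevels.lean.txt` 323d4d2dc7a5d402, farm
rc 0 · 0 sorry) with the last section (L)+(C) ⟹ (V) appended, and SPLIT into three files ≤ 400 lines by cell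
bsd-print-x8's prover p4 g2 because the gate refuses Theorems files from literature-prover seats (D-0016) and
proof files over 400 lines (lint.statement-form); bodies VERBATIM, docstrings added to helper lemmas
(lint.docstring). ROUTE-INDEPENDENT support (Literature + Mathlib imports only at the root); bears on route
`PrintX8` crux `MuBoundSmallImageX8` (stmt-BirchSwinnertonDyer-20622) through the VS road and on the sister
route `PrintX8VS` crux `ConjSpanGenAll` (stmt-BirchSwinnertonDyer-21705). beyond-print theorem: YES-candidate
(director W-36 sense) for the whole; PARTITION currency 0 by itself. BSD is not advanced by this file alone.

References: [Morris2007] Thm. 6.1 (2); [SerreSL2Congruence1970] §2.6 Thm. 2 (b), Cor. 1, Cor. 3;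
[Vaserstein1972SL2] Lemma 1, Theorem; [Manin1972] Prop. 1.4, Thm. 1.9; [Sun2007] §4 Conj. 8 (NOT proved here).
-/

set_option linter.dupNamespace false

namespace Summit.BirchSwinnertonDyer.BirchSwinnertonDyer.Theorems.ConjSpanGenAllLevels

noncomputable section

open scoped MatrixGroups
open CongruenceSubgroup
open Literature.NumberTheory.EllipticCurves.Rank1Residual

/-! ### The hypotheses of the abstract lemma -/

variable {p N : ℕ}

/-- `B⁺ ≤ Δ`. [folklore] -/
theorem upperB_le_Delta : upperB p ≤ Delta p N := by
  intro g hg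
  have h : g 1 0 = 0 := hg
  exact ⟨0, by simp [h]⟩

/-- `B⁻_N ≤ Δ`. [folklore] -/
theorem lowerP_le_Delta : lowerP p N ≤ Delta p N := fun _ hg => hg.2

/-- `ι Γ₀(N) ≤ Δ`. [folklore] -/
theorem gamma0Image_le_Delta : gamma0Image p N ≤ Delta p N := by
  rintro x ⟨γ, hγ, rfl⟩
  have h := (Gamma0_mem).1 hγ
  have h' : (N : ℤ) ∣ (γ : SL(2, ℤ)) 1 0 := (CharP.intCast_eq_zero_iff (ZMod N) N _).1 h
  obtain ⟨t, ht⟩ := h'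
  exact ⟨(t : Away p), by simp [ht]⟩

/-- (h1) `ι Γ₀(N) ∩ B⁻_N ⊆ ι S(N,p)`: such an element is `±(1 0; Nt 1)`, trace `±2`. -/
theorem h1_concrete (hp : p ≠ 0) :
    ∀ ⦃x⦄, x ∈ gamma0Image p N → x ∈ lowerP p N → x ∈ spanImage p N := by
  rintro x ⟨γ, hγ, rfl⟩ ⟨h01, -⟩
  have hb : (γ : SL(2, ℤ)) 0 1 = 0 := intCast_injective hp (by simpa using h01)
  have hdet := Matrix.SpecialLinearGroup.det_coe γ
  rw [Matrix.det_fin_two, hb, zero_mul, sub_zero] at hdet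
  have hmem : (⟨γ, hγ⟩ : Gamma0 N) ∈ spanSubgroup N p := by
    rcases Int.eq_one_or_neg_one_of_mul_eq_one' hdet with ⟨ha, hd⟩ | ⟨ha, hd⟩
    · refine mem_spanSubgroup_of_mem_spanGenerators (mem_spanGenerators_of_trEntry_eq_two ?_)
      simp only [trEntry, ha, hd]; norm_num
    · refine mem_spanSubgroup_of_mem_spanGenerators (mem_spanGenerators_of_trEntry_eq_neg_two ?_)
      simp only [trEntry, ha, hd]; norm_num
  exact ⟨γ, ⟨⟨γ, hγ⟩, hmem, rfl⟩, rfl⟩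

/-- (h2) `ι Γ₀(N) ∩ B⁺·B⁻_N ⊆ ι S(N,p)`: such an element has `d ∈ ℤ[1/p]ˣ ∩ ℤ = ±p^ℕ`, a GOOD element. -/
theorem h2_concrete (hp : p.Prime) :
    ∀ ⦃x b q⦄, x ∈ gamma0Image p N → b ∈ upperB p → q ∈ lowerP p N → x = b * q → x ∈ spanImage p N := by
  rintro x b q ⟨γ, hγ, rfl⟩ hb ⟨hq, -⟩ hx
  have hb' : b 1 0 = 0 := hb
  have e : (((γ : SL(2, ℤ)) 1 1 : ℤ) : Away p) = b 1 1 * q 1 1 := by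
    have := congrArg (fun g : SL(2, Away p) => g 1 1) hx
    simpa [Matrix.mul_apply, Fin.sum_univ_two, hb'] using this
  have hbu : IsUnit (b 1 1) := by
    have hdet := Matrix.SpecialLinearGroup.det_coe b
    rw [Matrix.det_fin_two, hb', mul_zero, sub_zero] at hdet
    exact IsUnit.of_mul_eq_one_right _ hdet
  have hqu : IsUnit (q 1 1) := by
    have hdet := Matrix.SpecialLinearGroup.det_coe q
    rw [Matrix.det_fin_two, hq, zero_mul, sub_zero] at hdet
    exact IsUnit.of_mul_eq_one_right _ hdet
  have hu : IsUnit ((((γ : SL(2, ℤ)) 1 1 : ℤ) : Away p)) := by rw [e]; exact hbu.mul hqu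
  obtain ⟨m, hm⟩ := natAbs_eq_pow_of_isUnit_intCast hp hu
  have hgood : IsGoodAt p (⟨γ, hγ⟩ : Gamma0 N) := ⟨m, hm⟩
  exact ⟨γ, ⟨⟨γ, hγ⟩, mem_spanSubgroup_of_mem_spanGenerators (mem_spanGenerators_of_isGoodAt hgood), rfl⟩, rfl⟩

/-- `E(N,p) ≤ ⟨B⁺ ∪ B⁻_N⟩` (each listed generator is triangular). -/
theorem triangularSubgroup_le :
    triangularSubgroup p N ≤ Subgroup.closure ((upperB p : Set SL(2, Away p)) ∪ (lowerP p N : Set _)) := by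
  rw [triangularSubgroup, Subgroup.closure_le]
  rintro g ((⟨t, rfl⟩ | ⟨t, rfl⟩) | hg)
  · apply Subgroup.subset_closure
    left
    show (upperUnip t) 1 0 = 0
    simp [upperUnip]
  · apply Subgroup.subset_closure
    right
    refine ⟨?_, t, ?_⟩
    · show (lowerUnip ((N : Away p) * t)) 0 1 = 0
      simp [lowerUnip]
    · show (lowerUnip ((N : Away p) * t)) 1 0 = (N : Away p) * t
      simp [lowerUnip]
  · apply Subgroup.subset_closure
    left
    rcases hg with rfl | rfl
    · show (diagP p) 1 0 = 0
      simp [diagP]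
    · show (negOne : SL(2, Away p)) 1 0 = 0
      simp [negOne]


/-- `E(A, NA) ≤ ⟨B⁺ ∪ B⁻_N⟩`. -/
theorem relE_le_closure :
    Literature.NumberTheory.Automorphic.SL2Rel.relE (⊤ : Ideal (Away p)) (Ideal.span {(N : Away p)}) ≤
      Subgroup.closure ((upperB p : Set SL(2, Away p)) ∪ (lowerP p N : Set _)) := by
  rw [Literature.NumberTheory.Automorphic.SL2Rel.relE, Subgroup.closure_le]
  rintro g (⟨x, -, rfl⟩ | ⟨y, hy, rfl⟩)
  · apply Subgroup.subset_closure
    left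
    show (Literature.NumberTheory.Automorphic.SL2Rel.e12 x) 1 0 = 0
    simp
  · apply Subgroup.subset_closure
    right
    obtain ⟨t, rfl⟩ := Ideal.mem_span_singleton'.1 hy
    refine ⟨?_, t, ?_⟩
    · show (Literature.NumberTheory.Automorphic.SL2Rel.e21 (t * (N : Away p))) 0 1 = 0
      simp
    · show (Literature.NumberTheory.Automorphic.SL2Rel.e21 (t * (N : Away p))) 1 0 = (N : Away p) * t
      simp [mul_comm]

/-- `ℤ`-congruence `d ≡ ±pᵏ (mod N)` read in `ZMod N` gives an integer multiple. -/
theorem exists_int_of_inGammaH {γ : Gamma0 N} (h : InGammaH N p γ) :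
    ∃ (s : ℤ) (k : ℕ), (s = 1 ∨ s = -1) ∧ ∃ t : ℤ, dEntry γ - s * (p : ℤ) ^ k = N * t := by
  obtain ⟨k, hk | hk⟩ := h
  · refine ⟨1, k, Or.inl rfl, ?_⟩
    have : ((dEntry γ : ℤ) : ZMod N) = (((p : ℤ) ^ k : ℤ) : ZMod N) := by rw [hk]; push_cast; rfl
    obtain ⟨t, ht⟩ := (ZMod.intCast_eq_intCast_iff_dvd_sub _ _ _).1 this.symm
    exact ⟨t, by rw [one_mul, ht]⟩
  · refine ⟨-1, k, Or.inr rfl, ?_⟩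
    have : ((dEntry γ : ℤ) : ZMod N) = ((-((p : ℤ) ^ k) : ℤ) : ZMod N) := by rw [hk]; push_cast; rfl
    obtain ⟨t, ht⟩ := (ZMod.intCast_eq_intCast_iff_dvd_sub _ _ _).1 this.symm
    exact ⟨t, by rw [neg_mul, one_mul, sub_neg_eq_add, ← sub_neg_eq_add]; simpa using ht⟩

/-- **(V) ⟹ (E′):** `ι γ ∈ ⟨B⁺ ∪ B⁻_N⟩` for `γ ∈ Γ_H(N)` — multiply `γ` by `diag(u, u⁻¹)`, `u = ±pᵏ ∈ ℤ[1/p]ˣ`,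
to land in `G(A, NA)` (MEMO-an §13.2 (iv), ref2 THMB-COLD-AUDIT-g8 §3b). -/
theorem iota_mem_closure_of_relGLeRelE (_hp : p.Prime) (hV : RelGLeRelE p N) (γ : Gamma0 N)
    (hγ : InGammaH N p γ) :
    iota p (γ : SL(2, ℤ)) ∈ Subgroup.closure ((upperB p : Set SL(2, Away p)) ∪ (lowerP p N : Set _)) := by
  obtain ⟨s, k, hs, t, ht⟩ := exists_int_of_inGammaH hγ
  -- the unit `u = s pᵏ`
  have hpu : IsUnit ((p : ℤ) : Away p) := by
    have := IsLocalization.Away.algebraMap_isUnit (S := Away p) (p : ℤ)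
    simpa using this
  have hsu : IsUnit ((s : ℤ) : Away p) := by
    rcases hs with rfl | rfl
    · simp
    · push_cast; exact (isUnit_one : IsUnit (1 : Away p)).neg
  have hxu : IsUnit (((s * (p : ℤ) ^ k : ℤ)) : Away p) := by
    push_cast
    exact hsu.mul (hpu.pow k)
  set u : (Away p)ˣ := hxu.unit with hu_def
  have hu : (u : Away p) = ((s * (p : ℤ) ^ k : ℤ) : Away p) := hxu.unit_spec
  -- `γ₀(N)`-condition on `c`
  have hc : (N : ℤ) ∣ (γ : SL(2, ℤ)) 1 0 :=
    (CharP.intCast_eq_zero_iff (ZMod N) N _).1 ((Gamma0_mem).1 γ.2)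
  obtain ⟨t₀, ht₀⟩ := hc
  set g : SL(2, Away p) := iota p (γ : SL(2, ℤ)) * diagUnit u with hg_def
  have hg00 : g 0 0 = (((γ : SL(2, ℤ)) 0 0 : ℤ) : Away p) * u := by
    simp [hg_def, Literature.NumberTheory.Automorphic.SL2Rel.mul_apply_two]
  have hg01 : g 0 1 = (((γ : SL(2, ℤ)) 0 1 : ℤ) : Away p) * ((u⁻¹ : (Away p)ˣ) : Away p) := by
    simp [hg_def, Literature.NumberTheory.Automorphic.SL2Rel.mul_apply_two]
  have hg10 : g 1 0 = (((γ : SL(2, ℤ)) 1 0 : ℤ) : Away p) * u := by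
    simp [hg_def, Literature.NumberTheory.Automorphic.SL2Rel.mul_apply_two]
  have hg11 : g 1 1 = (((γ : SL(2, ℤ)) 1 1 : ℤ) : Away p) * ((u⁻¹ : (Away p)ˣ) : Away p) := by
    simp [hg_def, Literature.NumberTheory.Automorphic.SL2Rel.mul_apply_two]
  have hI : (⊤ : Ideal (Away p)) * Ideal.span {(N : Away p)} = Ideal.span {(N : Away p)} := Ideal.top_mul _
  -- membership of `g` in `G(A, NA)`
  have h10 : g 1 0 ∈ Ideal.span {(N : Away p)} := by
    rw [hg10, ht₀]
    refine Ideal.mem_span_singleton'.2 ⟨(t₀ : Away p) * u, ?_⟩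
    push_cast; ring
  have h11 : g 1 1 - 1 ∈ Ideal.span {(N : Away p)} := by
    have e : g 1 1 - 1 = ((N : ℤ) : Away p) * (t : Away p) * ((u⁻¹ : (Away p)ˣ) : Away p) := by
      have h1 : (u : Away p) * ((u⁻¹ : (Away p)ˣ) : Away p) = 1 := Units.mul_inv u
      have hd : (((γ : SL(2, ℤ)) 1 1 : ℤ) : Away p) = (u : Away p) + ((N : ℤ) : Away p) * (t : Away p) := by
        have ht' := congrArg (fun z : ℤ => (z : Away p)) ht
        simp only [Int.cast_sub, Int.cast_mul, Int.cast_pow, Int.cast_natCast] at ht'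
        have hdd : (((γ : SL(2, ℤ)) 1 1 : ℤ) : Away p) = ((dEntry γ : ℤ) : Away p) := rfl
        rw [hu, hdd]; push_cast
        linear_combination ht'
      rw [hg11, hd, add_mul, h1]; ring
    rw [e]
    refine Ideal.mem_span_singleton'.2 ⟨(t : Away p) * ((u⁻¹ : (Away p)ˣ) : Away p), ?_⟩
    push_cast; ring
  have h00 : g 0 0 - 1 ∈ Ideal.span {(N : Away p)} := by
    have hdet := Matrix.SpecialLinearGroup.det_coe g
    rw [Matrix.det_fin_two] at hdet
    have e : g 0 0 - 1 = g 0 0 * (-(g 1 1 - 1)) + g 0 1 * g 1 0 := by linear_combination hdet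
    rw [e]
    exact Ideal.add_mem _ (Ideal.mul_mem_left _ _ ((Ideal.span {(N : Away p)}).neg_mem h11)) (Ideal.mul_mem_left _ _ h10)
  have hgG : g ∈ Literature.NumberTheory.Automorphic.SL2Rel.relG (⊤ : Ideal (Away p))
      (Ideal.span {(N : Away p)}) := by
    rw [Literature.NumberTheory.Automorphic.SL2Rel.mem_relG, hI]
    exact ⟨Submodule.mem_top, h10, h00, h11⟩
  have hgE := relE_le_closure (hV hgG)
  have hD : (diagUnit u)⁻¹ ∈ Subgroup.closure ((upperB p : Set SL(2, Away p)) ∪ (lowerP p N : Set _)) :=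
    Subgroup.subset_closure (Or.inl ((upperB p).inv_mem (diagUnit_mem_upperB u)))
  have : iota p (γ : SL(2, ℤ)) = g * (diagUnit u)⁻¹ := by rw [hg_def, mul_inv_cancel_right]
  rw [this]
  exact Subgroup.mul_mem _ hgE hD


/-! ### (h3), (h3′): `Δ = Γ₀(N)·B⁺ = Γ₀(N)·B⁻_N` — row and column reduction over `ℤ[1/p]` -/

/-- `pᵉ` is a unit of `ℤ[1/p]`. [folklore] -/
theorem isUnit_natCast_pow (e : ℕ) : IsUnit ((p : Away p) ^ e) := by
  have h := IsLocalization.Away.algebraMap_isUnit (S := Away p) (p : ℤ)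
  have h' : IsUnit (p : Away p) := by simpa using h
  exact h'.pow e

/-- Two elements of `ℤ[1/p]` have a common `p`-power denominator. -/
theorem exists_common_denom (x y : Away p) :
    ∃ (e : ℕ) (x₀ y₀ : ℤ), x * (p : Away p) ^ e = x₀ ∧ y * (p : Away p) ^ e = y₀ := by
  obtain ⟨⟨x₁, ⟨_, ⟨r, rfl⟩⟩⟩, hx⟩ := IsLocalization.surj (Submonoid.powers (p : ℤ)) x
  obtain ⟨⟨y₁, ⟨_, ⟨s, rfl⟩⟩⟩, hy⟩ := IsLocalization.surj (Submonoid.powers (p : ℤ)) y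
  have hx' : x * (p : Away p) ^ r = x₁ := by simpa using hx
  have hy' : y * (p : Away p) ^ s = y₁ := by simpa using hy
  refine ⟨r + s, x₁ * (p : ℤ) ^ s, y₁ * (p : ℤ) ^ r, ?_, ?_⟩
  · push_cast
    rw [pow_add, ← mul_assoc, hx']
  · push_cast
    rw [pow_add, mul_comm ((p : Away p) ^ r), ← mul_assoc, hy']

/-- A natural number which is a unit in `ℤ[1/p]` and divides `N`, `p ∤ N`, is `1`. -/
theorem eq_one_of_isUnit_natCast_of_dvd (hp : p.Prime) (hpN : ¬ p ∣ N) {G : ℕ}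
    (hG : IsUnit ((G : ℤ) : Away p)) (hGN : G ∣ N) : G = 1 := by
  obtain ⟨m, hm⟩ := natAbs_eq_pow_of_isUnit_intCast hp hG
  have hGm : G = p ^ m := by simpa using hm
  rcases Nat.eq_zero_or_pos m with h0 | hpos
  · simpa [h0] using hGm
  · exact absurd (dvd_trans (hGm ▸ dvd_pow_self p hpos.ne') hGN) hpN

/-- **(h3) `Δ = Γ₀(N)·B⁺`** (column reduction): the first column `(a/pʳ, Nc/pʳ)` of `g ∈ Δ` is, up to the
unit `gcd(a, Nc) = pʲ`, a primitive integer vector `(a₀, c₀)` with `N ∣ c₀` (as `p ∤ N`); complete it to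
`γ ∈ Γ₀(N)`; then `γ⁻¹ g` fixes `∞`. -/
theorem deltaEqGamma0MulUpper (hp : p.Prime) (hpN : ¬ p ∣ N) : DeltaEqGamma0MulUpper p N := by
  rintro g ⟨t, ht⟩
  obtain ⟨e, a, t₀, ha, ht₀⟩ := exists_common_denom (p := p) (g 0 0) t
  have hue : IsUnit ((p : Away p) ^ e) := isUnit_natCast_pow e
  have hdet := Matrix.SpecialLinearGroup.det_coe g
  rw [Matrix.det_fin_two, ht] at hdet
  -- the determinant, cleared of denominators
  have key : (a : Away p) * g 1 1 - g 0 1 * ((N : Away p) * t₀) = (p : Away p) ^ e := by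
    rw [← ha, ← ht₀]
    linear_combination (p : Away p) ^ e * hdet
  set G : ℕ := Int.gcd a (N * t₀) with hG
  obtain ⟨a₀, ha₀⟩ : (G : ℤ) ∣ a := Int.gcd_dvd_left ..
  obtain ⟨c₁, hc₁⟩ : (G : ℤ) ∣ N * t₀ := Int.gcd_dvd_right ..
  have hGunit : IsUnit ((G : ℤ) : Away p) := by
    refine isUnit_of_dvd_unit ⟨(a₀ : Away p) * g 1 1 - g 0 1 * (c₁ : Away p), ?_⟩ hue
    have hc₁' : ((N : Away p) * t₀) = ((G : ℤ) : Away p) * c₁ := by exact_mod_cast congrArg (fun z : ℤ => (z : Away p)) hc₁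
    rw [← key, hc₁', ha₀]
    push_cast
    ring
  obtain ⟨m, hm⟩ := natAbs_eq_pow_of_isUnit_intCast hp hGunit
  have hGpm : G = p ^ m := by simpa using hm
  have hGpos : 0 < G := by rw [hGpm]; exact pow_pos hp.pos m
  -- `gcd(a₀, c₁) = 1`
  have hcop : Int.gcd a₀ c₁ = 1 := by
    have h1 : G = G * Int.gcd a₀ c₁ := by
      conv_lhs => rw [hG, ha₀, hc₁, Int.gcd_mul_left]
      simp
    exact (Nat.eq_of_mul_eq_mul_left hGpos (h1.symm.trans (mul_one G).symm)).symm.symm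
  -- `N ∣ c₁`
  have hGN : IsCoprime ((G : ℕ) : ℤ) (N : ℤ) := by
    rw [Nat.isCoprime_iff_coprime, hGpm]
    exact Nat.Coprime.pow_left m (hp.coprime_iff_not_dvd.2 hpN)
  obtain ⟨t₁, ht₁⟩ : (G : ℤ) ∣ t₀ := hGN.dvd_of_dvd_mul_left ⟨c₁, by rw [← hc₁, mul_comm]⟩
  have hc₁N : c₁ = N * t₁ := by
    have h2 : (G : ℤ) * c₁ = (G : ℤ) * (N * t₁) := by rw [← hc₁, ht₁]; ring
    exact mul_left_cancel₀ (by exact_mod_cast hGpos.ne') h2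
  -- Bezout and the completing matrix
  obtain ⟨u, v, huv⟩ := Int.isCoprime_iff_gcd_eq_one.2 hcop
  let γ : SL(2, ℤ) := ⟨!![a₀, -v; c₁, u], by rw [Matrix.det_fin_two_of]; linear_combination huv⟩
  have e00 : (γ : Matrix (Fin 2) (Fin 2) ℤ) 0 0 = a₀ := rfl
  have e10 : (γ : Matrix (Fin 2) (Fin 2) ℤ) 1 0 = c₁ := rfl
  have hγ : γ ∈ Gamma0 N := by
    rw [Gamma0_mem, e10, hc₁N]
    push_cast
    simp
  refine ⟨γ, hγ, (iota p γ)⁻¹ * g, ?_, by rw [mul_inv_cancel_left]⟩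
  show ((iota p γ)⁻¹ * g) 1 0 = 0
  obtain ⟨-, -, h10, h11⟩ := Literature.NumberTheory.Automorphic.SL2Rel.inv_apply_two (iota p γ)
  rw [Literature.NumberTheory.Automorphic.SL2Rel.mul_apply_two, h10, h11, iota_apply, iota_apply, e00, e10]
  rw [← hue.mul_left_eq_zero]
  have hg10 : g 1 0 * (p : Away p) ^ e = (N : Away p) * t₀ := by rw [ht, ← ht₀]; ring
  calc (-(c₁ : Away p) * g 0 0 + (a₀ : Away p) * g 1 0) * (p : Away p) ^ e
      = -(c₁ : Away p) * (g 0 0 * (p : Away p) ^ e) + (a₀ : Away p) * (g 1 0 * (p : Away p) ^ e) := by ring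
    _ = -(c₁ : Away p) * a + (a₀ : Away p) * ((N : Away p) * t₀) := by rw [ha, hg10]
    _ = -(c₁ : Away p) * a + (a₀ : Away p) * ((N * t₀ : ℤ) : Away p) := by push_cast; ring
    _ = 0 := by rw [hc₁, ha₀]; push_cast; ring

/-- **(h3′) `Δ = Γ₀(N)·B⁻_N`** (row reduction on the second column; the extra point is `gcd(d₀, N) = 1`,
from the determinant and `p ∤ N`). -/
theorem deltaEqGamma0MulLower (hp : p.Prime) (hpN : ¬ p ∣ N) : DeltaEqGamma0MulLower p N := by
  rintro g ⟨t, ht⟩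
  obtain ⟨e, y₀, z₀, hy, hz⟩ := exists_common_denom (p := p) (g 0 1) (g 1 1)
  have hue : IsUnit ((p : Away p) ^ e) := isUnit_natCast_pow e
  have hdet := Matrix.SpecialLinearGroup.det_coe g
  rw [Matrix.det_fin_two, ht] at hdet
  have key : g 0 0 * (z₀ : Away p) - (y₀ : Away p) * ((N : Away p) * t) = (p : Away p) ^ e := by
    rw [← hz, ← hy]
    linear_combination (p : Away p) ^ e * hdet
  set G : ℕ := Int.gcd y₀ z₀ with hG
  obtain ⟨b₀, hb₀⟩ : (G : ℤ) ∣ y₀ := Int.gcd_dvd_left ..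
  obtain ⟨d₀, hd₀⟩ : (G : ℤ) ∣ z₀ := Int.gcd_dvd_right ..
  have hGunit : IsUnit ((G : ℤ) : Away p) := by
    refine isUnit_of_dvd_unit ⟨g 0 0 * (d₀ : Away p) - (b₀ : Away p) * ((N : Away p) * t), ?_⟩ hue
    rw [← key, hb₀, hd₀]
    push_cast
    ring
  obtain ⟨m, hm⟩ := natAbs_eq_pow_of_isUnit_intCast hp hGunit
  have hGpm : G = p ^ m := by simpa using hm
  have hGpos : 0 < G := by rw [hGpm]; exact pow_pos hp.pos m
  have hcop : Int.gcd b₀ d₀ = 1 := by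
    have h1 : G = G * Int.gcd b₀ d₀ := by
      conv_lhs => rw [hG, hb₀, hd₀, Int.gcd_mul_left]
      simp
    exact (Nat.eq_of_mul_eq_mul_left hGpos (h1.symm.trans (mul_one G).symm))
  -- `gcd(d₀, N) = 1`
  set G₂ : ℕ := Int.gcd d₀ N with hG₂
  obtain ⟨d₁, hd₁⟩ : (G₂ : ℤ) ∣ d₀ := Int.gcd_dvd_left ..
  obtain ⟨n₁, hn₁⟩ : (G₂ : ℤ) ∣ (N : ℤ) := Int.gcd_dvd_right ..
  have hG₂unit : IsUnit ((G₂ : ℤ) : Away p) := by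
    refine isUnit_of_dvd_unit ⟨g 0 0 * ((G : ℤ) : Away p) * (d₁ : Away p) - (y₀ : Away p) * ((n₁ : Away p) * t), ?_⟩ hue
    have hN' : (N : Away p) = ((N : ℤ) : Away p) := by push_cast; rfl
    rw [← key, hd₀, hd₁, hN', hn₁]
    push_cast
    ring
  have hG₂N : G₂ ∣ N := by
    have : ((G₂ : ℕ) : ℤ) ∣ ((N : ℕ) : ℤ) := ⟨n₁, hn₁⟩
    exact_mod_cast this
  have hG₂one : G₂ = 1 := eq_one_of_isUnit_natCast_of_dvd hp hpN hG₂unit hG₂N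
  obtain ⟨m', n', hmn⟩ := Int.isCoprime_iff_gcd_eq_one.2 (show Int.gcd d₀ N = 1 from hG₂one)
  obtain ⟨u, v, huv⟩ := Int.isCoprime_iff_gcd_eq_one.2 hcop
  -- the completing matrix `(a b₀; c d₀)` with `N ∣ c`
  let a : ℤ := v + u * m' * b₀
  let c : ℤ := -(u * n') * N
  have hc : c = -u + u * m' * d₀ := by
    show -(u * n') * N = -u + u * m' * d₀
    linear_combination (-u) * hmn
  have hdetγ : a * d₀ - b₀ * c = 1 := by
    rw [hc]
    show (v + u * m' * b₀) * d₀ - b₀ * (-u + u * m' * d₀) = 1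
    linear_combination huv
  let γ : SL(2, ℤ) := ⟨!![a, b₀; c, d₀], by rw [Matrix.det_fin_two_of]; exact hdetγ⟩
  have e00 : (γ : Matrix (Fin 2) (Fin 2) ℤ) 0 0 = a := rfl
  have e01 : (γ : Matrix (Fin 2) (Fin 2) ℤ) 0 1 = b₀ := rfl
  have e10 : (γ : Matrix (Fin 2) (Fin 2) ℤ) 1 0 = c := rfl
  have e11 : (γ : Matrix (Fin 2) (Fin 2) ℤ) 1 1 = d₀ := rfl
  have hγ : γ ∈ Gamma0 N := by
    rw [Gamma0_mem, e10]
    show (((-(u * n') * N : ℤ)) : ZMod N) = 0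
    push_cast
    simp
  refine ⟨γ, hγ, (iota p γ)⁻¹ * g, ⟨?_, ((u * n' : ℤ) : Away p) * g 0 0 + (a : Away p) * t, ?_⟩,
    by rw [mul_inv_cancel_left]⟩
  · show ((iota p γ)⁻¹ * g) 0 1 = 0
    obtain ⟨h00, h01, -, -⟩ := Literature.NumberTheory.Automorphic.SL2Rel.inv_apply_two (iota p γ)
    rw [Literature.NumberTheory.Automorphic.SL2Rel.mul_apply_two, h00, h01, iota_apply, iota_apply, e11, e01]
    rw [← hue.mul_left_eq_zero]
    calc ((d₀ : Away p) * g 0 1 + -(b₀ : Away p) * g 1 1) * (p : Away p) ^ e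
        = (d₀ : Away p) * (g 0 1 * (p : Away p) ^ e) - (b₀ : Away p) * (g 1 1 * (p : Away p) ^ e) := by ring
      _ = (d₀ : Away p) * y₀ - (b₀ : Away p) * z₀ := by rw [hy, hz]
      _ = 0 := by rw [hb₀, hd₀]; push_cast; ring
  · show ((iota p γ)⁻¹ * g) 1 0 = _
    have hcA : (c : Away p) = -(((u * n' : ℤ) : Away p) * (N : Away p)) := by
      show (((-(u * n') * (N : ℤ) : ℤ)) : Away p) = _
      push_cast
      ring
    obtain ⟨-, -, h10, h11⟩ := Literature.NumberTheory.Automorphic.SL2Rel.inv_apply_two (iota p γ)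
    rw [Literature.NumberTheory.Automorphic.SL2Rel.mul_apply_two, h10, h11, iota_apply, iota_apply, e00, e10,
      ht, hcA]
    ring


end

end Summit.BirchSwinnertonDyer.BirchSwinnertonDyer.Theorems.ConjSpanGenAllLevels
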